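import Literature.NumberTheory.EllipticCurves.AnalyticIsogenyDescentProofs
import Literature.NumberTheory.EllipticCurves.LatticeHomOfCurveKernelProofs
import Literature.NumberTheory.EllipticCurves.ModularCurve
import HarnessLib

/-!
# The `ℚ`-isogeny of a rational lattice inclusion `cΛ₁ ⊆ Λ₂` is `z ↦ cz` on algebraic points and has
# degree `[Λ₂ : cΛ₁]` (Silverman, *AEC*, Thm. VI.4.1(b) with III.4.10(c))

Topic `NumberTheory/EllipticCurves`; a proofs-only file (theorems only: no definitions, no named facts) in
`namespace Literature.NumberTheory.EllipticCurves`, sibling of `AnalyticIsogenyDescentProofs` and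
`NeronIsogenyScalingProofs`.

For Weierstrass models `W₁, W₂/ℚ` (`W₁` elliptic) with Néron-type period pairs `L₁, L₂`
(`g₂ = c₄/12`, `g₃ = c₆/216`), complex uniformisations `uᵢ : ℂ →+ Wᵢ(ℂ)` (kernel `Λᵢ`, `u₁` onto,
`uᵢ(z) = (℘_{Λᵢ}(z) − b₂/12, (℘′_{Λᵢ}(z) − a₁x − a₃)/2)` off `Λᵢ`), an embedding `j : ℚ̄ → ℂ` and `c ∈ ℚˣ`
with `cΛ₁ ⊆ Λ₂`, the tree constructs (`isIsogenous_of_forall_mul_mem_lattice`, and with the `x`-coordinate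
exported `exists_isogeny_x_eq_of_forall_mul_mem_lattice`) a `ℚ`-isogeny `φ : W₁ → W₂` by restricting the
analytic map `Φ : u₁(z) ↦ u₂(cz)` along `j`.  Those theorems record only `IsIsogenous` / the `x`-formula.  This
file re-runs the SAME construction and exports the two facts the tree lacked:

* **`φ` IS `z ↦ cz` on algebraic points**: `j_* m = u₁ z ⟹ j_* (φ m) = u₂ (c z)` for every `m ∈ W₁(ℚ̄)`;
* **`deg φ = [c⁻¹Λ₂ : Λ₁] = [Λ₂ : cΛ₁]`** (Silverman, *AEC*, Thm. VI.4.1(b) with III.4.10(c): the kernel of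
  `z ↦ cz` is `c⁻¹Λ₂/Λ₁`; every point of it is torsion, and all torsion of `W₁(ℂ)` is algebraic — both
  `n`-torsion groups have `n²` elements, `WeierstrassCurve.card_torsionBy_eq_sq`).

`exists_isogeny_apply_eq_degree_eq_of_forall_mul_mem_lattice` is the statement with the uniformisations and
`j` as data; `exists_isogeny_degree_eq_of_isNeronLatticeOf` the hypothesis-light corollary (only the degree).
Everything is proved; no statement of the tree is changed.  Written for the Birch–Swinnerton-Dyer cell
bsd-rank2 (line `nsf` on crux `StarOptBNSF`: the Shimura covering `E₁ → E₀` of an `X₀(N)`-optimal curve at a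
level with a traceless prime has odd degree), but the statement is general.

## References
* [SilvermanAEC2009] J. H. Silverman, *The Arithmetic of Elliptic Curves*, 2nd ed., GTM 106, Springer 2009:
  Thm. VI.4.1(b) (PDF pp. 152–154), III.4.10(c), Prop. VI.3.6(b), Thm. VI.5.3.
-/

noncomputable section

open scoped Classical
open Complex Set Polynomial Filter Topology

namespace Literature.NumberTheory.EllipticCurves

open WeierstrassCurve PeriodPair

/-! ### The construction with the analytic description and the degree exported -/

/-- **The `ℚ`-isogeny of a rational lattice inclusion, with its analytic description and its degree.**
Let `W₁, W₂` be Weierstrass models over `ℚ`, `W₁` elliptic, with period pairs `L₁, L₂` of Néron type, complex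
uniformisations `u₁, u₂` (`ker uᵢ = Λᵢ`, `u₁` onto, the `℘`-formula off the lattice), an embedding
`j : ℚ̄ →ₐ[ℚ] ℂ`, and `c ∈ ℚˣ` with `cΛ₁ ⊆ Λ₂`.  Then there is a `ℚ`-isogeny `φ : W₁ → W₂` (the tree's
`WeierstrassCurve.Isogeny`) such that (i) `j_* (φ m) = u₂ (c z)` whenever `j_* m = u₁ z` — `φ` is the analytic
isogeny `z ↦ cz` (Silverman, *AEC*, Thm. VI.4.1(b)) restricted to algebraic points — and (ii)
`deg φ = [c⁻¹Λ₂ : Λ₁]` (`= [Λ₂ : cΛ₁]`; *AEC* III.4.10(c): the kernel `c⁻¹Λ₂/Λ₁` of `z ↦ cz` consists of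
torsion points, all of which are algebraic).  The construction (descent of the transformation
`℘_{c⁻¹Λ₂} = (P₀/Q₀)(℘_{Λ₁})` to `ℚ(X)`, algebraicity, `Γ_ℚ`-equivariance) is verbatim that of the tree's
`isIsogenous_of_forall_mul_mem_lattice` (`AnalyticIsogenyDescentProofs`); new are the two exported clauses.
[cite: SilvermanAEC2009, Thm. VI.4.1(b) (PDF pp. 152–154) and III.4.10(c)] -/
theorem exists_isogeny_apply_eq_degree_eq_of_forall_mul_mem_lattice {W₁ W₂ : WeierstrassCurve ℚ}
    [W₁.IsElliptic] {L₁ L₂ : PeriodPair} (h₁₂ : L₁.g₂ = (W₁.baseChange ℂ).c₄ / 12)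
    (h₁₃ : L₁.g₃ = (W₁.baseChange ℂ).c₆ / 216) (h₂₂ : L₂.g₂ = (W₂.baseChange ℂ).c₄ / 12)
    (h₂₃ : L₂.g₃ = (W₂.baseChange ℂ).c₆ / 216)
    (u₁ : ℂ →+ (W₁.baseChange ℂ).toAffine.Point) (hker₁ : (u₁.ker : Set ℂ) = L₁.lattice)
    (hsurj₁ : Function.Surjective u₁)
    (hu₁ : ∀ z ∉ L₁.lattice, ∃ h, u₁ z = .some (℘[L₁] z - (W₁.baseChange ℂ).b₂ / 12)
        ((℘'[L₁] z - (W₁.baseChange ℂ).a₁ * (℘[L₁] z - (W₁.baseChange ℂ).b₂ / 12)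
          - (W₁.baseChange ℂ).a₃) / 2) h)
    (u₂ : ℂ →+ (W₂.baseChange ℂ).toAffine.Point) (hker₂ : (u₂.ker : Set ℂ) = L₂.lattice)
    (hu₂ : ∀ z ∉ L₂.lattice, ∃ h, u₂ z = .some (℘[L₂] z - (W₂.baseChange ℂ).b₂ / 12)
        ((℘'[L₂] z - (W₂.baseChange ℂ).a₁ * (℘[L₂] z - (W₂.baseChange ℂ).b₂ / 12)
          - (W₂.baseChange ℂ).a₃) / 2) h)
    (j : (AlgebraicClosure ℚ) →ₐ[ℚ] ℂ) {c : ℚ} (hc : c ≠ 0)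
    (hle : ∀ z ∈ L₁.lattice, (c : ℂ) * z ∈ L₂.lattice) :
    ∃ φ : Isogeny W₁ W₂,
      (∀ (m : W₁.geomPoints) (z : ℂ), Affine.Point.map (W' := W₁) j m = u₁ z →
        Affine.Point.map (W' := W₂) j (φ m) = u₂ ((c : ℂ) * z)) ∧
      φ.degree = L₁.lattice.toAddSubgroup.relIndex
        (L₂.lattice.toAddSubgroup.comap (AddMonoidHom.mulLeft (c : ℂ))) := by
  -- the uniformisations `uᵢ : ℂ/Λᵢ ≅ Wᵢ(ℂ)` are given
  have hu₁0 : ∀ z, u₁ z = 0 ↔ z ∈ L₁.lattice := fun z ↦ by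
    rw [← SetLike.mem_coe, ← hker₁, SetLike.mem_coe, AddMonoidHom.mem_ker]
  have hu₂0 : ∀ z, u₂ z = 0 ↔ z ∈ L₂.lattice := fun z ↦ by
    rw [← SetLike.mem_coe, ← hker₂, SetLike.mem_coe, AddMonoidHom.mem_ker]
  -- the lattice `Λ' = c⁻¹Λ₂ ⊇ Λ₁`
  have hcC : (c : ℂ) ≠ 0 := by exact_mod_cast hc
  have hci : (c : ℂ)⁻¹ ≠ 0 := inv_ne_zero hcC
  set L' : PeriodPair := L₂.mulLeft ((c : ℂ)⁻¹) hci with hL'def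
  have hL' : ∀ z, z ∈ L'.lattice ↔ (c : ℂ) * z ∈ L₂.lattice := fun z ↦ by
    rw [hL'def, PeriodPair.mem_mulLeft_lattice, inv_inv]
  have hLL' : L₁.lattice ≤ L'.lattice := fun z hz ↦ (hL' z).mpr (hle z hz)
  have h℘ : ∀ z, ℘[L₂] (c * z) = ((c : ℂ)⁻¹) ^ 2 * ℘[L'] z := fun z ↦ by
    have h := PeriodPair.weierstrassP_mulLeft ((c : ℂ)⁻¹) hci L₂ (c * z)
    rw [inv_mul_cancel_left₀ hcC, ← hL'def] at h
    rw [h, ← mul_assoc, mul_inv_cancel₀ (pow_ne_zero 2 hci), one_mul]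
  have h℘' : ∀ z, ℘'[L₂] (c * z) = ((c : ℂ)⁻¹) ^ 3 * ℘'[L'] z := fun z ↦ by
    have h := PeriodPair.derivWeierstrassP_mulLeft ((c : ℂ)⁻¹) hci L₂ (c * z)
    rw [inv_mul_cancel_left₀ hcC, ← hL'def] at h
    rw [h, ← mul_assoc, mul_inv_cancel₀ (pow_ne_zero 3 hci), one_mul]
  -- the invariants are rational
  have hg₂ : ∃ q : ℚ, (q : ℂ) = L₁.g₂ :=
    ⟨W₁.c₄ / 12, by rw [h₁₂, WeierstrassCurve.baseChange, WeierstrassCurve.map_c₄, eq_ratCast]; push_cast; ring⟩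
  have hg₃ : ∃ q : ℚ, (q : ℂ) = L₁.g₃ :=
    ⟨W₁.c₆ / 216, by rw [h₁₃, WeierstrassCurve.baseChange, WeierstrassCurve.map_c₆, eq_ratCast]; push_cast; ring⟩
  have hg₂' : ∃ q : ℚ, (q : ℂ) = L'.g₂ :=
    ⟨c ^ 4 * W₂.c₄ / 12, by
      rw [hL'def, PeriodPair.g₂_mulLeft, h₂₂, WeierstrassCurve.baseChange, WeierstrassCurve.map_c₄,
        eq_ratCast, inv_pow, inv_inv]; push_cast; ring⟩
  have hg₃' : ∃ q : ℚ, (q : ℂ) = L'.g₃ :=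
    ⟨c ^ 6 * W₂.c₆ / 216, by
      rw [hL'def, PeriodPair.g₃_mulLeft, h₂₃, WeierstrassCurve.baseChange, WeierstrassCurve.map_c₆,
        eq_ratCast, inv_pow, inv_inv]; push_cast; ring⟩
  -- the transformation `℘_{Λ'} = (P₀/Q₀)(℘_{Λ₁})` over `ℚ`, and its derivative
  obtain ⟨P₀, Q₀, hQ₀m, -, hQ', hPQ'⟩ :=
    L₁.exists_rat_polynomial_weierstrassP_mul_eval_eq_of_le L' hLL' hg₂ hg₃ hg₂' hg₃'
  have hQ : ∀ z ∉ L'.lattice, aeval (℘[L₁] z) Q₀ ≠ 0 := fun z hz ↦ by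
    rw [← eval_map_algebraMap]; exact hQ' z hz
  have hPQ : ∀ z ∉ L'.lattice, ℘[L'] z * aeval (℘[L₁] z) Q₀ = aeval (℘[L₁] z) P₀ := fun z hz ↦ by
    rw [← eval_map_algebraMap, ← eval_map_algebraMap]; exact hPQ' z hz
  have hder : ∀ z ∉ L'.lattice, ℘'[L'] z * aeval (℘[L₁] z) Q₀ ^ 2 =
      ℘'[L₁] z * aeval (℘[L₁] z) (derivative P₀ * Q₀ - P₀ * derivative Q₀) := fun z hz ↦ by
    have h := L₁.derivWeierstrassP_mul_eval_sq_eq_of_le L' hLL' hPQ' hz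
    rw [Polynomial.derivative_map, Polynomial.derivative_map, ← Polynomial.map_mul,
      ← Polynomial.map_mul, ← Polynomial.map_sub, eval_map_algebraMap, eval_map_algebraMap] at h
    exact h
  -- freeze the numerator of the derivative of the transformation
  set N₀ : ℚ[X] := derivative P₀ * Q₀ - P₀ * derivative Q₀ with hN₀
  -- an embedding `j : ℚ̄ → ℂ` and the induced injections on points
  haveI hQbar : Algebra.IsAlgebraic ℚ (AlgebraicClosure ℚ) := AlgebraicClosure.isAlgebraic ℚ
  set jW₁ := (Affine.Point.map (W' := W₁) j : W₁.geomPoints →+ (W₁.baseChange ℂ).toAffine.Point)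
    with hjW₁
  set jW₂ := (Affine.Point.map (W' := W₂) j : W₂.geomPoints →+ (W₂.baseChange ℂ).toAffine.Point)
    with hjW₂
  have hj₁ : Function.Injective jW₁ := Affine.Point.map_injective (W' := W₁) j
  have hj₂ : Function.Injective jW₂ := Affine.Point.map_injective (W' := W₂) j
  -- the analytic isogeny `Φ : W₁(ℂ) → W₂(ℂ)`, `u₁ z ↦ u₂ (cz)`
  obtain ⟨Φ, hΦ⟩ : ∃ Φ : (W₁.baseChange ℂ).toAffine.Point →+ (W₂.baseChange ℂ).toAffine.Point,
      ∀ z, Φ (u₁ z) = u₂ (c * z) := by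
    refine exists_addMonoidHom_apply_eq u₁ hsurj₁ (u₂.comp (AddMonoidHom.mulLeft (c : ℂ)))
      fun z hz ↦ ?_
    rw [AddMonoidHom.coe_comp, Function.comp_apply, AddMonoidHom.coe_mulLeft, hu₂0]
    exact hle z ((hu₁0 z).mp hz)
  -- representatives of `Λ'/Λ₁` and the finite exceptional set
  obtain ⟨S, hS0, -, hS, -⟩ := L₁.exists_finset_representatives L' hLL'
  have hkerΦ : ∀ z, Φ (u₁ z) = 0 → u₁ z ∈ u₁ '' (S : Set ℂ) := by
    intro z hz
    rw [hΦ, hu₂0, ← hL'] at hz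
    obtain ⟨s, hs, hzs⟩ := (hS z).mp hz
    refine ⟨s, hs, ?_⟩
    have h0 : u₁ (z - s) = 0 := (hu₁0 _).mpr hzs
    rwa [map_sub, sub_eq_zero, eq_comm] at h0
  set β₁ : (AlgebraicClosure ℚ) := algebraMap ℚ (AlgebraicClosure ℚ) W₁.b₂ / 12 with hβ₁
  set Bad : Set W₁.geomPoints := {m | jW₁ m ∈ u₁ '' (S : Set ℂ)} ∪
    {m | ∃ (x y : (AlgebraicClosure ℚ)) (h : (W₁.baseChange (AlgebraicClosure ℚ)).toAffine.Nonsingular x y),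
      m = .some x y h ∧ ((Q₀.map (algebraMap ℚ (AlgebraicClosure ℚ))).comp (X + C β₁)).eval x = 0} with hBad
  have hBadfin : Bad.Finite := by
    refine Set.Finite.union ?_ ?_
    · exact (S.finite_toSet.image u₁).preimage hj₁.injOn
    · refine finite_setOf_eval_x_eq_zero W₁ (Monic.ne_zero ?_)
      exact (hQ₀m.map _).comp (monic_X_add_C β₁) (by rw [natDegree_X_add_C]; exact one_ne_zero)
  have hevalQ : ∀ x : (AlgebraicClosure ℚ), ((Q₀.map (algebraMap ℚ (AlgebraicClosure ℚ))).comp (X + C β₁)).eval x = aeval (x + β₁) Q₀ := by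
    intro x
    rw [eval_comp, eval_add, eval_X, eval_C, eval_map_algebraMap]
  -- good points: affine, `Q₀(x + β₁) ≠ 0`, and `j m = u₁ z` with `z ∉ Λ'`
  have hgood : ∀ m : W₁.geomPoints, m ∉ Bad → ∃ (x y : (AlgebraicClosure ℚ))
      (h : (W₁.baseChange (AlgebraicClosure ℚ)).toAffine.Nonsingular x y), m = .some x y h ∧
      aeval (x + β₁) Q₀ ≠ 0 ∧ ∃ z, z ∉ L'.lattice ∧ jW₁ m = u₁ z := by
    intro m hm
    simp only [hBad, Set.mem_union, Set.mem_setOf_eq, not_or, not_exists, not_and] at hm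
    obtain ⟨z, hz⟩ := hsurj₁ (jW₁ m)
    have hzL' : z ∉ L'.lattice := by
      intro hzm
      obtain ⟨s, hs, hzs⟩ := (hS z).mp hzm
      apply hm.1
      refine ⟨s, hs, ?_⟩
      have h0 : u₁ (z - s) = 0 := (hu₁0 _).mpr hzs
      rw [map_sub, sub_eq_zero] at h0
      rw [← hz, h0]
    rcases m with _ | ⟨x, y, h⟩
    · exfalso
      apply hm.1
      refine ⟨0, hS0, ?_⟩
      rw [map_zero]
      exact (map_zero jW₁).symm
    · refine ⟨x, y, h, rfl, ?_, z, hzL', hz.symm⟩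
      rw [← hevalQ]
      exact hm.2 x y h rfl
  -- the `ℚ̄`-rational formula for `Φ` at good points
  have hformula : ∀ {x y : (AlgebraicClosure ℚ)} (hxy : (W₁.baseChange (AlgebraicClosure ℚ)).toAffine.Nonsingular x y) {z : ℂ},
      z ∉ L'.lattice → jW₁ (.some x y hxy) = u₁ z →
      ∃ h₂ : (W₂.baseChange (AlgebraicClosure ℚ)).toAffine.Nonsingular
        (((algebraMap ℚ (AlgebraicClosure ℚ) c)⁻¹ ^ 2 * aeval (x + algebraMap ℚ (AlgebraicClosure ℚ) W₁.b₂ / 12) P₀ -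
            algebraMap ℚ (AlgebraicClosure ℚ) W₂.b₂ / 12 * aeval (x + algebraMap ℚ (AlgebraicClosure ℚ) W₁.b₂ / 12) Q₀) /
          aeval (x + algebraMap ℚ (AlgebraicClosure ℚ) W₁.b₂ / 12) Q₀)
        (((algebraMap ℚ (AlgebraicClosure ℚ) c)⁻¹ ^ 3 *
              aeval (x + algebraMap ℚ (AlgebraicClosure ℚ) W₁.b₂ / 12) N₀ *
              (2 * y + algebraMap ℚ (AlgebraicClosure ℚ) W₁.a₁ * x + algebraMap ℚ (AlgebraicClosure ℚ) W₁.a₃) -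
            algebraMap ℚ (AlgebraicClosure ℚ) W₂.a₁ *
              ((algebraMap ℚ (AlgebraicClosure ℚ) c)⁻¹ ^ 2 * aeval (x + algebraMap ℚ (AlgebraicClosure ℚ) W₁.b₂ / 12) P₀ -
                algebraMap ℚ (AlgebraicClosure ℚ) W₂.b₂ / 12 * aeval (x + algebraMap ℚ (AlgebraicClosure ℚ) W₁.b₂ / 12) Q₀) *
              aeval (x + algebraMap ℚ (AlgebraicClosure ℚ) W₁.b₂ / 12) Q₀ -
            algebraMap ℚ (AlgebraicClosure ℚ) W₂.a₃ * aeval (x + algebraMap ℚ (AlgebraicClosure ℚ) W₁.b₂ / 12) Q₀ ^ 2) /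
          (2 * aeval (x + algebraMap ℚ (AlgebraicClosure ℚ) W₁.b₂ / 12) Q₀ ^ 2)),
      jW₂ (.some _ _ h₂) = Φ (jW₁ (.some x y hxy)) := by
    intro x y hxy z hzL' hz
    obtain ⟨h₂, hh₂⟩ := map_some_eq_uniformize_mul_of_transformation j hu₁ hu₂ hle hL' h℘ h℘'
      hQ hPQ hder hxy hzL' hz
    exact ⟨h₂, by rw [hz, hΦ]; exact hh₂⟩
  -- `Φ` preserves `j(W₁(ℚ̄))`
  have hpres : ∀ m : W₁.geomPoints, Φ (jW₁ m) ∈ jW₂.range := by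
    set T : AddSubgroup W₁.geomPoints := (jW₂.range.comap Φ).comap jW₁ with hT
    have hTtop : T = ⊤ := by
      refine AddSubgroup.eq_top_of_finite_compl T (hBadfin.subset fun m hm ↦ ?_)
      by_contra hmB
      apply hm
      obtain ⟨x, y, h, rfl, -, z, hzL', hz⟩ := hgood m hmB
      obtain ⟨h₂, hm₂⟩ := hformula h hzL' hz
      rw [hT, SetLike.mem_coe, AddSubgroup.mem_comap, AddSubgroup.mem_comap]
      exact ⟨_, hm₂⟩
    intro m
    have : m ∈ T := by rw [hTtop]; exact AddSubgroup.mem_top m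
    rw [hT, AddSubgroup.mem_comap, AddSubgroup.mem_comap] at this
    exact this
  -- the restriction `φ` of `Φ` along `j`
  set eR : W₂.geomPoints ≃+ jW₂.range := AddMonoidHom.ofInjective hj₂ with heR
  set φ : W₁.geomPoints →+ W₂.geomPoints :=
    eR.symm.toAddMonoidHom.comp ((Φ.comp jW₁).codRestrict jW₂.range fun m ↦ hpres m) with hφ
  have hfφ : ∀ m, jW₂ (φ m) = Φ (jW₁ m) := by
    intro m
    have h1 : ((eR (φ m) : jW₂.range) : (W₂.baseChange ℂ).toAffine.Point) = jW₂ (φ m) :=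
      AddMonoidHom.ofInjective_apply hj₂
    rw [← h1, hφ, AddMonoidHom.coe_comp, Function.comp_apply, AddEquiv.coe_toAddMonoidHom,
      AddEquiv.apply_symm_apply]
    rfl
  -- the value of `φ` at a good point
  have hφval : ∀ {x y : (AlgebraicClosure ℚ)} (hxy : (W₁.baseChange (AlgebraicClosure ℚ)).toAffine.Nonsingular x y) {z : ℂ},
      z ∉ L'.lattice → jW₁ (.some x y hxy) = u₁ z → ∃ h₂, φ (.some x y hxy) = .some
        (((algebraMap ℚ (AlgebraicClosure ℚ) c)⁻¹ ^ 2 * aeval (x + algebraMap ℚ (AlgebraicClosure ℚ) W₁.b₂ / 12) P₀ -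
            algebraMap ℚ (AlgebraicClosure ℚ) W₂.b₂ / 12 * aeval (x + algebraMap ℚ (AlgebraicClosure ℚ) W₁.b₂ / 12) Q₀) /
          aeval (x + algebraMap ℚ (AlgebraicClosure ℚ) W₁.b₂ / 12) Q₀)
        (((algebraMap ℚ (AlgebraicClosure ℚ) c)⁻¹ ^ 3 *
              aeval (x + algebraMap ℚ (AlgebraicClosure ℚ) W₁.b₂ / 12) N₀ *
              (2 * y + algebraMap ℚ (AlgebraicClosure ℚ) W₁.a₁ * x + algebraMap ℚ (AlgebraicClosure ℚ) W₁.a₃) -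
            algebraMap ℚ (AlgebraicClosure ℚ) W₂.a₁ *
              ((algebraMap ℚ (AlgebraicClosure ℚ) c)⁻¹ ^ 2 * aeval (x + algebraMap ℚ (AlgebraicClosure ℚ) W₁.b₂ / 12) P₀ -
                algebraMap ℚ (AlgebraicClosure ℚ) W₂.b₂ / 12 * aeval (x + algebraMap ℚ (AlgebraicClosure ℚ) W₁.b₂ / 12) Q₀) *
              aeval (x + algebraMap ℚ (AlgebraicClosure ℚ) W₁.b₂ / 12) Q₀ -
            algebraMap ℚ (AlgebraicClosure ℚ) W₂.a₃ * aeval (x + algebraMap ℚ (AlgebraicClosure ℚ) W₁.b₂ / 12) Q₀ ^ 2) /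
          (2 * aeval (x + algebraMap ℚ (AlgebraicClosure ℚ) W₁.b₂ / 12) Q₀ ^ 2)) h₂ := by
    intro x y hxy z hzL' hz
    obtain ⟨h₂, hm₂⟩ := hformula hxy hzL' hz
    exact ⟨h₂, hj₂ (by rw [hfφ, hm₂])⟩
  -- `φ` is algebraic
  have halg : IsAlgebraicOn W₁ W₂ φ := by
    set Tm : MvPolynomial (Fin 2) (AlgebraicClosure ℚ) := MvPolynomial.X 0 + MvPolynomial.C β₁ with hTm
    set κ : (AlgebraicClosure ℚ) := (algebraMap ℚ (AlgebraicClosure ℚ) c)⁻¹ with hκ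
    set Pm : MvPolynomial (Fin 2) (AlgebraicClosure ℚ) := MvPolynomial.C (κ ^ 2) * Polynomial.aeval Tm P₀ -
      MvPolynomial.C (algebraMap ℚ (AlgebraicClosure ℚ) W₂.b₂ / 12) * Polynomial.aeval Tm Q₀ with hPm
    refine ⟨Pm, Polynomial.aeval Tm Q₀,
      MvPolynomial.C (κ ^ 3) * Polynomial.aeval Tm N₀ *
          (MvPolynomial.C 2 * MvPolynomial.X 1 + MvPolynomial.C (algebraMap ℚ (AlgebraicClosure ℚ) W₁.a₁) *
            MvPolynomial.X 0 + MvPolynomial.C (algebraMap ℚ (AlgebraicClosure ℚ) W₁.a₃)) -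
        MvPolynomial.C (algebraMap ℚ (AlgebraicClosure ℚ) W₂.a₁) * Pm * Polynomial.aeval Tm Q₀ -
        MvPolynomial.C (algebraMap ℚ (AlgebraicClosure ℚ) W₂.a₃) * Polynomial.aeval Tm Q₀ ^ 2,
      MvPolynomial.C 2 * Polynomial.aeval Tm Q₀ ^ 2, hBadfin.subset fun m hm ↦ ?_⟩
    by_contra hmB
    apply hm
    obtain ⟨x, y, h, rfl, hQx, z, hzL', hz⟩ := hgood m hmB
    obtain ⟨h₂, hφm⟩ := hφval h hzL' hz
    have heQ : MvPolynomial.eval ![x, y] (Polynomial.aeval Tm Q₀) = aeval (x + β₁) Q₀ :=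
      eval_aeval_X_zero_add_C Q₀ β₁ x y
    have heP : MvPolynomial.eval ![x, y] (Polynomial.aeval Tm P₀) = aeval (x + β₁) P₀ :=
      eval_aeval_X_zero_add_C P₀ β₁ x y
    have heN : MvPolynomial.eval ![x, y] (Polynomial.aeval Tm N₀) =
        aeval (x + β₁) N₀ :=
      eval_aeval_X_zero_add_C _ β₁ x y
    refine ⟨x, y, h, rfl, ?_, ?_, ?_⟩
    · rw [heQ]; exact hQx
    · simp only [map_mul, map_pow, MvPolynomial.eval_C, heQ]
      exact mul_ne_zero two_ne_zero (pow_ne_zero 2 hQx)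
    · have hx₂ : MvPolynomial.eval ![x, y] Pm / MvPolynomial.eval ![x, y] (Polynomial.aeval Tm Q₀) =
          ((algebraMap ℚ (AlgebraicClosure ℚ) c)⁻¹ ^ 2 * aeval (x + algebraMap ℚ (AlgebraicClosure ℚ) W₁.b₂ / 12) P₀ -
            algebraMap ℚ (AlgebraicClosure ℚ) W₂.b₂ / 12 * aeval (x + algebraMap ℚ (AlgebraicClosure ℚ) W₁.b₂ / 12) Q₀) /
          aeval (x + algebraMap ℚ (AlgebraicClosure ℚ) W₁.b₂ / 12) Q₀ := by
        simp only [hPm, map_sub, map_mul, MvPolynomial.eval_C, heQ, heP, hκ, hβ₁]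
      have hy₂ : MvPolynomial.eval ![x, y]
            (MvPolynomial.C (κ ^ 3) * Polynomial.aeval Tm N₀ *
              (MvPolynomial.C 2 * MvPolynomial.X 1 + MvPolynomial.C (algebraMap ℚ (AlgebraicClosure ℚ) W₁.a₁) *
                MvPolynomial.X 0 + MvPolynomial.C (algebraMap ℚ (AlgebraicClosure ℚ) W₁.a₃)) -
            MvPolynomial.C (algebraMap ℚ (AlgebraicClosure ℚ) W₂.a₁) * Pm * Polynomial.aeval Tm Q₀ -
            MvPolynomial.C (algebraMap ℚ (AlgebraicClosure ℚ) W₂.a₃) * Polynomial.aeval Tm Q₀ ^ 2) /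
          MvPolynomial.eval ![x, y] (MvPolynomial.C 2 * Polynomial.aeval Tm Q₀ ^ 2) =
          ((algebraMap ℚ (AlgebraicClosure ℚ) c)⁻¹ ^ 3 *
              aeval (x + algebraMap ℚ (AlgebraicClosure ℚ) W₁.b₂ / 12) N₀ *
              (2 * y + algebraMap ℚ (AlgebraicClosure ℚ) W₁.a₁ * x + algebraMap ℚ (AlgebraicClosure ℚ) W₁.a₃) -
            algebraMap ℚ (AlgebraicClosure ℚ) W₂.a₁ *
              ((algebraMap ℚ (AlgebraicClosure ℚ) c)⁻¹ ^ 2 * aeval (x + algebraMap ℚ (AlgebraicClosure ℚ) W₁.b₂ / 12) P₀ -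
                algebraMap ℚ (AlgebraicClosure ℚ) W₂.b₂ / 12 * aeval (x + algebraMap ℚ (AlgebraicClosure ℚ) W₁.b₂ / 12) Q₀) *
              aeval (x + algebraMap ℚ (AlgebraicClosure ℚ) W₁.b₂ / 12) Q₀ -
            algebraMap ℚ (AlgebraicClosure ℚ) W₂.a₃ * aeval (x + algebraMap ℚ (AlgebraicClosure ℚ) W₁.b₂ / 12) Q₀ ^ 2) /
          (2 * aeval (x + algebraMap ℚ (AlgebraicClosure ℚ) W₁.b₂ / 12) Q₀ ^ 2) := by
        simp only [hPm, map_sub, map_mul, map_add, map_pow, MvPolynomial.eval_C, MvPolynomial.eval_X,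
          heQ, heP, heN, hκ, hβ₁, Matrix.cons_val_zero, Matrix.cons_val_one]
      refine ⟨by rw [hx₂, hy₂]; exact h₂, ?_⟩
      rw [hφm]
      exact Affine.Point.some.congr_simp _ _ hx₂.symm _ _ hy₂.symm _
  -- `φ` commutes with the Galois group
  have hequiv : ∀ (τ : Field.absoluteGaloisGroup ℚ) (P : W₁.geomPoints), φ (τ • P) = τ • φ P := by
    intro τ
    -- `τ` as an algebra endomorphism of `ℚ̄`, and its action on points
    let τ' : (AlgebraicClosure ℚ) ≃ₐ[ℚ] (AlgebraicClosure ℚ) := τ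
    set τₕ : (AlgebraicClosure ℚ) →ₐ[ℚ] (AlgebraicClosure ℚ) := (τ' : (AlgebraicClosure ℚ) →ₐ[ℚ] (AlgebraicClosure ℚ)) with hτₕ
    have hτinj' : Function.Injective τₕ := fun a b hab ↦ τ'.injective hab
    have hsmul₂ : ∀ P : W₂.geomPoints, τ • P = Affine.Point.map τₕ P := fun _ ↦ rfl
    -- the two homomorphisms `P ↦ φ (τ P)` and `P ↦ τ (φ P)` agree off a finite set
    have hτinj : Function.Injective (fun P : W₁.geomPoints ↦ τ • P) := MulAction.injective τ
    have hfin : (Bad ∪ (fun P : W₁.geomPoints ↦ τ • P) ⁻¹' Bad).Finite :=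
      hBadfin.union (hBadfin.preimage hτinj.injOn)
    have heq : φ.comp (DistribSMul.toAddMonoidHom W₁.geomPoints τ) =
        (DistribSMul.toAddMonoidHom W₂.geomPoints τ).comp φ := by
      refine AddMonoidHom.eq_of_eqOn_compl_finite hfin fun P hP ↦ ?_
      simp only [Set.mem_union, Set.mem_preimage, not_or] at hP
      obtain ⟨x, y, h, rfl, -, z, hzL', hz⟩ := hgood P hP.1
      obtain ⟨x', y', h', hP', -, z', hzL'', hz'⟩ := hgood _ hP.2
      have hns : (W₁.baseChange (AlgebraicClosure ℚ)).toAffine.Nonsingular (τₕ x) (τₕ y) :=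
        (W₁.toAffine.baseChange_nonsingular hτinj' x y).mpr h
      have hτP : τ • (show W₁.geomPoints from Affine.Point.some x y h) =
          (show W₁.geomPoints from Affine.Point.some (τₕ x) (τₕ y) hns) := rfl
      rw [hτP] at hP' hz'
      obtain ⟨hx', hy'⟩ := Affine.Point.some.inj hP'
      subst hx' hy'
      obtain ⟨h₂, hφP⟩ := hφval h hzL' hz
      obtain ⟨h₂', hφP'⟩ := hφval hns hzL'' hz'
      show φ (τ • (show W₁.geomPoints from Affine.Point.some x y h)) =
        τ • φ (show W₁.geomPoints from Affine.Point.some x y h)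
      rw [hτP, hφP', hφP, hsmul₂]
      erw [Affine.Point.map_some]
      refine Affine.Point.some.congr_simp _ _ ?_ _ _ ?_ _
      · simp only [map_div₀, map_sub, map_mul, map_add, map_pow, map_inv₀, map_ofNat,
          AlgHom.commutes, ← Polynomial.aeval_algHom_apply]
      · simp only [map_div₀, map_sub, map_mul, map_add, map_pow, map_inv₀, map_ofNat,
          AlgHom.commutes, ← Polynomial.aeval_algHom_apply]
    intro P
    exact congrArg (fun g : W₁.geomPoints →+ W₂.geomPoints ↦ g P) heq
  -- the isogeny
  set ψ : Isogeny W₁ W₂ :=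
    { toAddMonoidHom := φ
      isAlgebraic := halg
      equivariant := hequiv
      finite_ker := halg.finite_ker } with hψ
  have hψφ : ∀ m, ψ m = φ m := fun _ ↦ rfl
  refine ⟨ψ, fun m z hm ↦ ?_, ?_⟩
  · -- (i) `ψ` is `z ↦ cz` on algebraic points
    have hm' : jW₁ m = u₁ z := hm
    have h := hfφ m
    rw [hm', hΦ] at h
    exact h
  · -- (ii) the degree: `ker ψ ≅ c⁻¹Λ₂ / Λ₁` through `u₁` and `j`
    -- all torsion of `W₁(ℂ)` is algebraic (both `n`-torsion groups have `n²` elements)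
    have htors : ∀ n : ℕ, 0 < n → ∀ P : (W₁.baseChange ℂ).toAffine.Point, n • P = 0 →
        P ∈ jW₁.range := by
      intro n hn P hP
      haveI : (W₁.baseChange (AlgebraicClosure ℚ)).IsElliptic := by
        rw [WeierstrassCurve.baseChange]; infer_instance
      haveI : (W₁.baseChange ℂ).IsElliptic := by
        rw [WeierstrassCurve.baseChange]; infer_instance
      have h1 : Nat.card (AddSubgroup.torsionBy W₁.geomPoints (n : ℤ)) = n ^ 2 :=
        WeierstrassCurve.card_torsionBy_eq_sq (E := W₁.baseChange (AlgebraicClosure ℚ))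
          (by exact_mod_cast hn.ne')
      have h2 : Nat.card (AddSubgroup.torsionBy (W₁.baseChange ℂ).toAffine.Point (n : ℤ)) = n ^ 2 :=
        WeierstrassCurve.card_torsionBy_eq_sq (E := W₁.baseChange ℂ) (by exact_mod_cast hn.ne')
      set T₁ : Set W₁.geomPoints :=
        (AddSubgroup.torsionBy W₁.geomPoints (n : ℤ) : Set W₁.geomPoints) with hT₁
      set T₂ : Set (W₁.baseChange ℂ).toAffine.Point :=
        (AddSubgroup.torsionBy (W₁.baseChange ℂ).toAffine.Point (n : ℤ) :
          Set (W₁.baseChange ℂ).toAffine.Point) with hT₂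
      have hsub : jW₁ '' T₁ ⊆ T₂ := by
        rintro _ ⟨m, hm, rfl⟩
        have hm' : n • m = 0 := AddSubgroup.torsionBy.nsmul_iff.mp hm
        have hgoal : n • jW₁ m = 0 := by rw [← map_nsmul, hm']; exact map_zero jW₁
        exact AddSubgroup.torsionBy.nsmul_iff.mpr hgoal
      have hT₂fin : T₂.Finite := by
        have : Finite (AddSubgroup.torsionBy (W₁.baseChange ℂ).toAffine.Point (n : ℤ)) :=
          Nat.finite_of_card_ne_zero (by rw [h2]; exact pow_ne_zero 2 hn.ne')
        exact Set.toFinite _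
      have hcard : T₂.ncard ≤ (jW₁ '' T₁).ncard := by
        rw [Set.ncard_image_of_injective _ hj₁, ← Nat.card_coe_set_eq, ← Nat.card_coe_set_eq]
        exact (h2.trans h1.symm).le
      have heq : jW₁ '' T₁ = T₂ := Set.eq_of_subset_of_ncard_le hsub hcard hT₂fin
      have hP' : P ∈ T₂ := AddSubgroup.torsionBy.nsmul_iff.mpr hP
      rw [← heq] at hP'
      obtain ⟨m, -, hm⟩ := hP'
      exact ⟨m, hm⟩
    -- `A = c⁻¹Λ₂` and the restriction `g` of `u₁` to `A`
    set A : AddSubgroup ℂ := L₂.lattice.toAddSubgroup.comap (AddMonoidHom.mulLeft (c : ℂ)) with hA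
    have hmemA : ∀ z, z ∈ A ↔ (c : ℂ) * z ∈ L₂.lattice := fun z ↦ Iff.rfl
    set g : A →+ (W₁.baseChange ℂ).toAffine.Point := u₁.comp A.subtype with hg
    have hgker : g.ker = L₁.lattice.toAddSubgroup.addSubgroupOf A := by
      ext z
      simp only [hg, AddMonoidHom.mem_ker, AddMonoidHom.coe_comp, Function.comp_apply,
        AddSubgroup.coe_subtype, hu₁0, AddSubgroup.mem_addSubgroupOf, Submodule.mem_toAddSubgroup]
    -- the index `[A : Λ₁]` is finite: `N := [Λ₂ : cΛ₁] ≠ 0` bounds the torsion orders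
    have hleC : (L₁.mulLeft (c : ℂ) hcC).lattice ≤ L₂.lattice :=
      PeriodPair.mulLeft_lattice_le_of_forall_mul_mem hcC hle
    have hN0 : (L₁.mulLeft (c : ℂ) hcC).lattice.toAddSubgroup.relIndex L₂.lattice.toAddSubgroup ≠ 0 :=
      PeriodPair.relIndex_mulLeft_ne_zero hcC hleC
    -- the image of `g` is `j_* (ker ψ)`
    have hgrange : g.range = ψ.toAddMonoidHom.ker.map jW₁ := by
      ext P
      simp only [AddMonoidHom.mem_range, AddSubgroup.mem_map]
      constructor
      · rintro ⟨⟨z, hz⟩, rfl⟩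
        obtain ⟨n, hn, -, hnz⟩ := AddSubgroup.exists_nsmul_mem_of_relIndex_ne_zero hN0
          (a := (c : ℂ) * z) ((hmemA z).1 hz)
        have hnz' : (n : ℂ) * z ∈ L₁.lattice := by
          have h1 : n • ((c : ℂ) * z) ∈ (L₁.mulLeft (c : ℂ) hcC).lattice := (AddSubgroup.mem_inf.1 hnz).1
          rw [nsmul_eq_mul, ← mul_assoc, mul_comm (n : ℂ) (c : ℂ), mul_assoc] at h1
          exact PeriodPair.mul_mem_mulLeft_lattice.mp h1
        have htor : n • u₁ z = 0 := by
          rw [← map_nsmul, nsmul_eq_mul]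
          exact (hu₁0 _).2 hnz'
        obtain ⟨m, hm⟩ := htors n hn _ htor
        refine ⟨m, ?_, ?_⟩
        · change φ m = 0
          have h0 : u₂ ((c : ℂ) * z) = 0 := (hu₂0 _).2 ((hmemA z).1 hz)
          apply hj₂
          rw [hfφ, hm, hΦ, h0]
          exact (map_zero jW₂).symm
        · exact hm
      · rintro ⟨m, hm0, rfl⟩
        obtain ⟨z, hz⟩ := hsurj₁ (jW₁ m)
        have hm0' : φ m = 0 := hm0
        have hΦ0 : Φ (u₁ z) = 0 := by
          rw [hz, ← hfφ, hm0']
          exact map_zero jW₂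
        have hzA : z ∈ A := by
          rw [hmemA, ← hu₂0, ← hΦ]
          exact hΦ0
        exact ⟨⟨z, hzA⟩, hz⟩
    -- count
    have hcard : Nat.card (ψ.toAddMonoidHom.ker.map jW₁) = Nat.card ψ.toAddMonoidHom.ker :=
      Nat.card_congr (ψ.toAddMonoidHom.ker.equivMapOfInjective jW₁ hj₁).toEquiv.symm
    rw [Isogeny.degree, AddSubgroup.relIndex, ← hgker, AddSubgroup.index_ker, hgrange, hcard]

/-! ### Corollary: the degree alone -/

/-- **The `ℚ`-isogeny of a rational lattice inclusion has degree `[Λ₂ : cΛ₁]`.** For elliptic `W₁, W₂/ℚ`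
with Néron period pairs `L₁, L₂` (`IsNeronLatticeOf`) and `c ∈ ℚˣ` with `cΛ₁ ⊆ Λ₂` there is a `ℚ`-isogeny
`φ : W₁ → W₂` with `deg φ = [c⁻¹Λ₂ : Λ₁]`, the index being taken as
`Λ₁.relIndex (comap (z ↦ cz) Λ₂)` (Silverman, *AEC*, Thm. VI.4.1(b), III.4.10(c); the uniformisation is the
tree's `PeriodPair.exists_addMonoidHom_of_g₂_g₃'`, the embedding `ℚ̄ → ℂ` any `IsAlgClosed.lift`).
[cite: SilvermanAEC2009, Thm. VI.4.1(b) (PDF pp. 152–154) and III.4.10(c)] -/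
theorem exists_isogeny_degree_eq_of_isNeronLatticeOf (W₁ W₂ : WeierstrassCurve ℚ) [W₁.IsElliptic]
    {L₁ L₂ : PeriodPair} (hL₁ : ModularForms.IsNeronLatticeOf (W₁.baseChange ℂ) L₁)
    (hL₂ : ModularForms.IsNeronLatticeOf (W₂.baseChange ℂ) L₂) {c : ℚ} (hc : c ≠ 0)
    (hle : ∀ z ∈ L₁.lattice, (c : ℂ) * z ∈ L₂.lattice) :
    ∃ φ : Isogeny W₁ W₂, φ.degree = L₁.lattice.toAddSubgroup.relIndex
        (L₂.lattice.toAddSubgroup.comap (AddMonoidHom.mulLeft (c : ℂ))) := by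
  obtain ⟨u₁, hker₁, hsurj₁, hu₁⟩ := L₁.exists_addMonoidHom_of_g₂_g₃' hL₁.1 hL₁.2
  obtain ⟨u₂, hker₂, -, hu₂⟩ := L₂.exists_addMonoidHom_of_g₂_g₃' hL₂.1 hL₂.2
  haveI hQbar : Algebra.IsAlgebraic ℚ (AlgebraicClosure ℚ) := AlgebraicClosure.isAlgebraic ℚ
  obtain ⟨j⟩ : Nonempty ((AlgebraicClosure ℚ) →ₐ[ℚ] ℂ) := ⟨IsAlgClosed.lift⟩
  obtain ⟨φ, -, hdeg⟩ := exists_isogeny_apply_eq_degree_eq_of_forall_mul_mem_lattice hL₁.1 hL₁.2 hL₂.1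
    hL₂.2 u₁ hker₁ hsurj₁ hu₁ u₂ hker₂ hu₂ j hc hle
  exact ⟨φ, hdeg⟩

end Literature.NumberTheory.EllipticCurves

end
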